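import Summits.Ventures.PercRepro.MSTightExtSideRow

/-!
# Theorem (i) TightExt in the column exception

The mirror of MSTightExtSideRow: `T = insert m K` is a tight one-point extension of a covering
excess-one `K` in a tight twin-free `P` without minimum or maximum member, and **no member of `K`
lies inside the addable part `R = Rstar T`**. Then `R = m` is the minimum of `T`, every difference
of `T` is `t \ m`, every `P₀`-eligible `p` contains `m`, and every member of `P` not containing
`m` is `P₁`-eligible, so it lies inside `∪K` — which is therefore `∪P`. For a `P₀`-eligible
`p ∉ K` containing `m`: with an element `a ∈ m` missing from a member of `P` (no minimum member),
either `a` is removable and `p \ {a}`, or `a` is addable and `(p \ Rstar P) ∪ (Rstar P).erase a`,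
is a member of `P` not containing `m`; its difference from the member `insert e m ∈ K`
(MinInsert) is `t \ m` for a member `t` of `T`, which turns out to be `p` (resp. `p ∪ Rstar P`,
and then `p ∈ T` by convexity). Hence `p = m`: `extension_side_of_column`.
-/

namespace PercRepro.MSTight

open Finset
open scoped FinsetFamily symmDiff

variable {α : Type*} [DecidableEq α] [Fintype α]

/-- **Theorem (i), the column exception.** -/
theorem extension_side_of_column {P K : Finset (Finset α)} {m : Finset α} (hP : Tight P)
    (htf : ∀ a b, Twin P a b → a = b) (hmin : ∀ t ∈ P, ∃ p ∈ P, ¬ t ⊆ p)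
    (hmax : ∀ t ∈ P, ∃ p ∈ P, ¬ p ⊆ t) (hKP : K ⊆ P) (hne : K.Nonempty)
    (hT : Tight (insert m K)) (hmP : m ∈ P)
    (hm1 : ∀ k ∈ K, m \ k ∈ K \\ K) (hm0 : ∀ k ∈ K, k \ m ∈ K \\ K)
    (hcov : ∀ p ∈ P, p ∉ K → (∀ k ∈ K, p \ k ∈ K \\ K) ∨ (∀ k ∈ K, k \ p ∈ K \\ K))
    (hcol : ∀ k ∈ K, ¬ k ⊆ Rstar (insert m K)) :
    ∀ p ∈ P, p ∉ K → (∀ k ∈ K, k \ p ∈ K \\ K) → p = m := by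
  set T := insert m K with hTdef
  set R := Rstar T with hR
  have hmT : m ∈ T := mem_insert_self m K
  have hRT : R ∈ T := Rstar_mem_of_dichotomy (dichotomy_of_tight hT) ⟨m, hmT⟩
  have hRm : R = m := by
    rcases mem_insert.1 hRT with h | h
    · exact h
    · exact absurd (subset_refl R) (hcol R h)
  have hDKT : K \\ K ⊆ T \\ T := diffs_subset (subset_insert m K) (subset_insert m K)
  -- every member of `T` contains `m`
  have hTm : ∀ t ∈ T, m ⊆ t := by
    intro t ht
    have h1 : t ∩ R ∈ T :=
      inter_Rstar_mem_of_sdiff_mem hT (subset_refl R) (mem_diffs.2 ⟨R, hRT, t, ht, rfl⟩)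
    rcases mem_insert.1 h1 with h | h
    · rw [← h]
      exact inter_subset_left
    · exact absurd inter_subset_right (hcol _ h)
  have hKm : ∀ k ∈ K, m ⊆ k := fun k hk => hTm k (mem_insert_of_mem hk)
  -- the differences of `T` are the sets `t \ m`
  have hDform : ∀ d ∈ T \\ T, ∃ t ∈ T, d = t \ m := by
    intro d hd
    rw [diffs_eq_flip_of_tight hT] at hd
    obtain ⟨t, ht, htd⟩ := mem_flip.1 hd
    refine ⟨t, ht, ?_⟩
    rw [← htd, ← hR, hRm]
    ext x
    simp only [mem_symmDiff, mem_sdiff]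
    constructor
    · rintro (h | ⟨hxm, hxt⟩)
      · exact h
      · exact absurd (hTm t ht hxm) hxt
    · intro h
      exact Or.inl h
  have hDm : ∀ d ∈ T \\ T, ∀ x ∈ d, x ∉ m := by
    intro d hd
    obtain ⟨t, -, rfl⟩ := hDform d hd
    exact fun x hx => (mem_sdiff.1 hx).2
  -- `P₀`-eligible sets contain `m`
  have hsupm : ∀ p, (∀ k ∈ K, k \ p ∈ K \\ K) → m ⊆ p := by
    intro p hp x hx
    obtain ⟨k, hk⟩ := hne
    by_contra hxp
    exact hDm _ (hDKT (hp k hk)) x (mem_sdiff.2 ⟨hKm k hk hx, hxp⟩) hx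
  -- twin-freeness of `T` on its support
  have hTtf := twinFree_support_insert_of_ext hm1 hm0 hne
    fun a b ha ha' hab => eq_of_twin_of_cover htf hcov hab ha ha'
  -- `insert g m ∈ K` for `g ∉ m` lying in some member of `K` (MinInsert)
  have hminT : ∀ A ∈ T, A ⊆ m → A = m := fun A hA h => Subset.antisymm h (hTm A hA)
  have hinsert : ∀ g, g ∉ m → (∃ k ∈ K, g ∈ k) → insert g m ∈ K := by
    intro g hg hgin
    obtain ⟨k, hk, hgk⟩ := hgin
    have hcls : cls T g = {g} :=
      cls_eq_singleton_of_twinFree_support hTtf ⟨k, mem_insert_of_mem hk, hgk⟩ ⟨m, hmT, hg⟩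
    have h1 := insert_mem_of_tight_of_minimal hT hmT hminT hg hcls ⟨k, mem_insert_of_mem hk, hgk⟩
    rcases mem_insert.1 h1 with h | h
    · exfalso
      have h2 : g ∈ insert g m := mem_insert_self g m
      rw [h] at h2
      exact hg h2
    · exact h
  -- members of `P` not containing `m` are `P₁`-eligible
  have hout1 : ∀ p₁ ∈ P, ¬ m ⊆ p₁ → ∀ k ∈ K, p₁ \ k ∈ K \\ K := by
    intro p₁ hp₁ hnsub
    have hp₁K : p₁ ∉ K := fun h => hnsub (hKm p₁ h)
    rcases hcov p₁ hp₁ hp₁K with h | h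
    · exact h
    · exact absurd (hsupm p₁ h) hnsub
  -- hence they lie inside `∪K`
  have hsupp_sub : ∀ b, (∀ k ∈ K, b ∉ k) → ∀ p₁ ∈ P, ¬ m ⊆ p₁ → b ∉ p₁ := by
    intro b hb p₁ hp₁ hnsub hbp
    obtain ⟨k, hk⟩ := hne
    obtain ⟨k₁, hk₁, k₂, -, h⟩ := mem_diffs.1 (hout1 p₁ hp₁ hnsub k hk)
    have : b ∈ p₁ \ k := mem_sdiff.2 ⟨hbp, hb k hk⟩
    rw [← h] at this
    exact hb k₁ hk₁ (mem_sdiff.1 this).1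
  -- an element `a ∈ m` missing from a member of `P`
  obtain ⟨p₁, hp₁, hp₁m⟩ := hmin m hmP
  obtain ⟨a, ham, hap₁⟩ := not_subset.1 hp₁m
  have hain : ∃ p ∈ P, a ∈ p := ⟨m, hmP, ham⟩
  have haout : ∃ p ∈ P, a ∉ p := ⟨p₁, hp₁, hap₁⟩
  -- `∪K = ∪P`
  have hsuppP : ∀ b, (∀ k ∈ K, b ∉ k) → ∀ p ∈ P, b ∉ p := by
    intro b hb p hp hbp
    obtain ⟨k₀, hk₀⟩ := hne
    have hba : a ≠ b := fun h => hb k₀ hk₀ (h ▸ hKm k₀ hk₀ ham)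
    obtain ⟨p', hp', hbp', hap'⟩ := exists_mem_notMem_of_ne hP htf ⟨p, hp, hbp⟩
      ⟨k₀, hKP hk₀, hb k₀ hk₀⟩ haout hba
    exact hsupp_sub b hb p' hp' (fun h => hap' (h ham)) hbp'
  -- `T` is down-closed above `m` on members of `P`
  have hconv : ∀ t ∈ T, ∀ q ∈ P, m ⊆ q → q ⊆ t → q ∈ T := by
    intro t ht q hq hmq hqt
    refine mem_of_subset_of_subset_of_twinClosed_of_tight hT hmT ht hmq hqt ?_
    intro x y hxy hx
    by_cases hxout : ∃ t' ∈ T, x ∉ t'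
    · rw [← hTtf x y ⟨t, ht, hqt hx⟩ hxout hxy]
      exact hx
    · push Not at hxout
      have hym : y ∈ m := (hxy m hmT).1 (hxout m hmT)
      exact hmq hym
  -- the main argument
  intro p hp hpK hp0
  have hmp : m ⊆ p := hsupm p hp0
  by_contra hpne
  have hpT : p ∉ T := by
    intro h
    rcases mem_insert.1 h with h' | h'
    · exact hpne h'
    · exact hpK h'
  -- the difference of a member not containing `m` from `insert e m` recovers a member of `T`
  have hkey : ∀ q' ∈ P, ¬ m ⊆ q' → ∀ e, e ∉ m → (∃ k ∈ K, e ∈ k) →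
      m ∪ (q'.erase e) ∈ T := by
    intro q' hq' hq'm e he hein
    have hke : insert e m ∈ K := hinsert e he hein
    obtain ⟨t, ht, htd⟩ := hDform _ (hDKT (hout1 q' hq' hq'm _ hke))
    have e1 : t = m ∪ (q'.erase e) := by
      ext x
      constructor
      · intro hx
        by_cases hxm : x ∈ m
        · exact mem_union_left _ hxm
        · have h2 : x ∈ t \ m := mem_sdiff.2 ⟨hx, hxm⟩
          rw [← htd] at h2
          obtain ⟨hxq, hxk⟩ := mem_sdiff.1 h2
          refine mem_union_right _ (mem_erase.2 ⟨?_, hxq⟩)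
          rintro rfl
          exact hxk (mem_insert_self x m)
      · intro hx
        rcases mem_union.1 hx with hxm | hxq
        · exact hTm t ht hxm
        · obtain ⟨hxe, hxq⟩ := mem_erase.1 hxq
          by_cases hxm : x ∈ m
          · exact hTm t ht hxm
          · have h2 : x ∈ q' \ insert e m := mem_sdiff.2 ⟨hxq, fun h => by
              rcases mem_insert.1 h with h' | h'
              · exact hxe h'
              · exact hxm h'⟩
            rw [htd] at h2
            exact (mem_sdiff.1 h2).1
    rw [← e1]
    exact ht
  have hcls : cls P a = {a} := cls_eq_singleton_of_twinFree htf a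
  -- `e ∉ p` lying in some member of `K`
  have hnotsupp : ∀ e, (∃ p' ∈ P, e ∈ p') → ∃ k ∈ K, e ∈ k := by
    intro e he
    by_contra h
    push Not at h
    obtain ⟨p', hp', hep'⟩ := he
    exact hsuppP e h p' hp' hep'
  by_cases haR : a ∈ Rstar P
  · -- `a` addable: `(p \ Rstar P) ∪ (Rstar P).erase a` is a member not containing `m`
    have hq' : (p \ Rstar P) ∪ (Rstar P).erase a ∈ P :=
      sdiff_Rstar_union_erase_mem hP htf hain haout haR hp
    have hq'm : ¬ m ⊆ (p \ Rstar P) ∪ (Rstar P).erase a := by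
      intro h
      have := h ham
      simp only [mem_union, mem_sdiff, mem_erase] at this
      rcases this with ⟨-, h'⟩ | ⟨h', -⟩
      · exact h' haR
      · exact h' rfl
    obtain ⟨e, heq, hein⟩ := exists_notMem_union_Rstar_mem hP hmax hp
    have hep : e ∉ p := fun h => heq (mem_union_left _ h)
    have heR : e ∉ Rstar P := fun h => heq (mem_union_right _ h)
    have hem : e ∉ m := fun h => hep (hmp h)
    have h1 := hkey _ hq' hq'm e hem (hnotsupp e hein)
    have e2 : m ∪ ((p \ Rstar P) ∪ (Rstar P).erase a).erase e = p ∪ Rstar P := by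
      ext x
      simp only [mem_union, mem_erase, mem_sdiff]
      constructor
      · rintro (hxm | ⟨-, ⟨hxp, -⟩ | ⟨-, hxR⟩⟩)
        · exact Or.inl (hmp hxm)
        · exact Or.inl hxp
        · exact Or.inr hxR
      · rintro (hxp | hxR)
        · by_cases hxR : x ∈ Rstar P
          · by_cases hxa : x = a
            · exact Or.inl (hxa ▸ ham)
            · exact Or.inr ⟨fun h => hep (h ▸ hxp), Or.inr ⟨hxa, hxR⟩⟩
          · exact Or.inr ⟨fun h => hep (h ▸ hxp), Or.inl ⟨hxp, hxR⟩⟩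
        · by_cases hxa : x = a
          · exact Or.inl (hxa ▸ ham)
          · exact Or.inr ⟨fun h => heR (h ▸ hxR), Or.inr ⟨hxa, hxR⟩⟩
    rw [e2] at h1
    exact hpT (hconv _ h1 p hp hmp subset_union_left)
  · -- `a` removable: `p \ {a}` is a member not containing `m`
    have hrem : ClosedRem P {a} := by
      have := closedRem_of_notMem_Rstar (dichotomy_of_tight hP) haR
      rwa [hcls] at this
    have hq' : p \ {a} ∈ P := hrem p hp
    have hq'm : ¬ m ⊆ p \ {a} := fun h => (mem_sdiff.1 (h ham)).2 (mem_singleton_self a)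
    obtain ⟨p'', hp'', hpp''⟩ := hmax p hp
    obtain ⟨e, hep'', hep⟩ := not_subset.1 hpp''
    have hem : e ∉ m := fun h => hep (hmp h)
    have h1 := hkey _ hq' hq'm e hem (hnotsupp e ⟨p'', hp'', hep''⟩)
    have e2 : m ∪ (p \ {a}).erase e = p := by
      ext x
      simp only [mem_union, mem_erase, mem_sdiff, mem_singleton]
      constructor
      · rintro (hxm | ⟨-, hxp, -⟩)
        · exact hmp hxm
        · exact hxp
      · intro hxp
        by_cases hxa : x = a
        · exact Or.inl (hxa ▸ ham)
        · exact Or.inr ⟨fun h => hep (h ▸ hxp), hxp, hxa⟩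
    rw [e2] at h1
    exact hpT h1

end PercRepro.MSTight
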